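import Summits.CriticalPhenomena.PercolationContinuityZ3.Theorems.PercAnnulusCrossingTubeRateConverse
import Summits.CriticalPhenomena.PercolationContinuityZ3.Theorems.PercAnnulusCrossingTubeCorrelationLengthCritical
import HarnessLib

/-!
# RSW3 lane: the TUBE CORRELATION LENGTH, VII — bridges to the typed obligation node
# `Crossing.GeometricHardCrossingLowerBound` (defs file 2, v2)

builds on p205010 (kernel theorem, internal audit signed; external expert review pending)

RSW3 lane (LANE 3 `prim-rsw3`), lead seat, gen 4.  Helper file (`--supports`); no definitions, no named facts, no
sorries.  `GeometricHardCrossingLowerBound` (defs file 2 v2: `∃ c > 0, ∀ K n ≥ 1, c^K ≤ P_{p_c}(boxCross (hardShape K n) 0)`) is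
the single statement behind parts I–VI; this file records, against the typed Prop:

* `geometricHardCrossingLowerBound_iff_rate_bounded` — **⟺ `∃ C, ∀ n ≥ 1, n·μ_{p_c}(n) ≤ C`** (the tube correlation length
  is linear in the width; part II `rate_bounded_iff_exp_hardCrossing`);
* `geometricHardCrossingLowerBound_of_cube_and_condBlockGluing` — **⇐ `CrossingLowerBound cubeShape 0 ∧ CondBlockGluing`**
  (part II); `crossingLowerBound_cube_of_geometricHardCrossingLowerBound` — **⇒ the cube** (`K = 1`);
* `frequently_multGluing_of_geometricHardCrossingLowerBound` — **⇒ for every `n ≥ 1`, a multiplicative gluing inequality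
  `c′·H(a;n)·Π(n) ≤ H(a+n-⌊n/2⌋; n)` for infinitely many `a`** (part VI).

So, at `p_c(ℤ³)`: cube ∧ (mult./cond. block gluing ∀ a) ⟹ `GeometricHardCrossingLowerBound` ⟺ `ξ_{p_c}(n) ≥ n/C`
⟹ cube ∧ (mult. gluing for infinitely many `a`, every `n`).  Census (non-rigorous): `c ≈ e^{-2.74}`, `Π ≈ 0.285`,
`g·h ≈ 0.85`.

References: H. Kesten, *Percolation Theory for Mathematicians* (1982), §3.3 Comment (v); G. Grimmett, *Percolation* (1999), §11.7.
-/

noncomputable section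

namespace Summit.CriticalPhenomena.PercolationContinuityZ3.Theorems.Crossing

open MeasureTheory Filter Topology Literature.Probability.LatticeModels Literature.Probability.Percolation SimpleGraph
open Summit.CriticalPhenomena.PercolationContinuityZ3.Theorems.SurfaceTension
open Summit.CriticalPhenomena.PercolationContinuityZ3.Theorems.Rsw3
open Summit.CriticalPhenomena.PercolationContinuityZ3.Theses

/-- **Geometric RSW ⟺ bounded rate**: `GeometricHardCrossingLowerBound ↔ ∃ C, ∀ n ≥ 1, n·μ_{p_c}(n) ≤ C`.
[cite: Kesten1982, §3.3 Comment (v)] -/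
theorem geometricHardCrossingLowerBound_iff_rate_bounded (hp : 0 < ((criticalProbI 3 : unitInterval) : ℝ)) :
    GeometricHardCrossingLowerBound ↔
      ∃ C : ℝ, ∀ n : ℕ, 1 ≤ n → (n : ℝ) * -(subadditive_log_hardCrossing (criticalProbI 3) hp n).lim ≤ C :=
  (rate_bounded_iff_exp_hardCrossing (criticalProbI 3) hp).symm

/-- **Cube ∧ conditional block gluing ⇒ geometric RSW.** [cite: Kesten1982, §3.3 Comment (v)] -/
theorem geometricHardCrossingLowerBound_of_cube_and_condBlockGluing (hcube : CrossingLowerBound cubeShape 0)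
    (h : CondBlockGluing) : GeometricHardCrossingLowerBound := by
  have hp : 0 < ((criticalProbI 3 : unitInterval) : ℝ) := by
    rw [coe_criticalProbI]; exact criticalProb_zd_pos 3 (by norm_num)
  exact (geometricHardCrossingLowerBound_iff_rate_bounded hp).2 (rate_bounded_of_cube_and_condBlockGluing hp hcube h)

/-- **Geometric RSW ⇒ the cube** (`K = 1`: `hardShape 1 n = cubeShape n`). [cite: Kesten1982, §3.3 (3.28)] -/
theorem crossingLowerBound_cube_of_geometricHardCrossingLowerBound (h : GeometricHardCrossingLowerBound) :
    CrossingLowerBound cubeShape 0 := by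
  obtain ⟨c, hc, hcK⟩ := h
  refine ⟨c, hc, fun n hn => ?_⟩
  have h1 := hcK 1 n le_rfl hn
  have hs : hardShape 1 n = cubeShape n := by
    ext j; fin_cases j <;> simp [hardShape, cubeShape]
  rw [pow_one, hs] at h1
  exact h1

/-- **Geometric RSW ⇒ multiplicative gluing infinitely often** (every `n ≥ 1`): there is `c′ > 0` (depending on the
geometric constant only) with `c′·H(a;n)·Π(n) ≤ H(a+n-⌊n/2⌋; n)` for infinitely many `a` (part VI). [cite: Kesten1982, §3.3 Comment (v)] -/
theorem frequently_multGluing_of_geometricHardCrossingLowerBound (h : GeometricHardCrossingLowerBound) :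
    ∃ c' : ℝ, 0 < c' ∧ ∀ n : ℕ, 1 ≤ n → ∃ᶠ a : ℕ in atTop,
      c' * ((bondPercolation (zdGraph 3) (criticalProbI 3)).real (boxCross (![(a : ℤ), n, n] : Site 3) 0) *
          (bondPercolation (zdGraph 3) (criticalProbI 3)).real (boxCross (cubeShape n) 0)) ≤
        (bondPercolation (zdGraph 3) (criticalProbI 3)).real (boxCross (![((a + n - n / 2 : ℕ) : ℤ), n, n] : Site 3) 0) := by
  have hp : 0 < ((criticalProbI 3 : unitInterval) : ℝ) := by
    rw [coe_criticalProbI]; exact criticalProb_zd_pos 3 (by norm_num)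
  obtain ⟨C, hC⟩ := (geometricHardCrossingLowerBound_iff_rate_bounded hp).1 h
  exact ⟨Real.exp (-(C + 1)), Real.exp_pos _, fun n hn => frequently_multGluing_of_rate_bounded hp hC hn⟩

end Summit.CriticalPhenomena.PercolationContinuityZ3.Theorems.Crossing

end
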